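import Mathlib
import HarnessLib
import Summits.HubbardSuperconductivity.HubbardSuperconductivity.Theses.ChiralWindow
import Summits.HubbardSuperconductivity.HubbardSuperconductivity.Theorems.ChiralWindowDefsBoxAt
import Summits.HubbardSuperconductivity.HubbardSuperconductivity.Theorems.ChiralWindowDefsRecordL
import Summits.HubbardSuperconductivity.HubbardSuperconductivity.Theorems.ChiralWindowCwKLChiralWindowRecordXL

/-!
# Skeleton v11 (line `Sketch`, lead c5) for crux `CwKLChiralWindow` (stmt-HubbardSuperconductivity-1741)

`CwKLChiralWindow_of : CwKLChiralWindow` from FOUR stubs, one per box of the CONCRETE rational record literal `klCertL`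
(`Theorems/ChiralWindowDefsRecordL.lean`, p141000; `klCertL.checkX = true` is a kernel decision) — each the certified interval-arithmetic
computation of the enclosures E1, E2, E3R, E4 (five channel blocks, `KLBlock.EnclosureR`) and E5S, E6 (`KLBox.NodeEnclosureS`) of ONE box,
uniformly in `μ` over that box (`KLCert.BoxEnclosureAt`, `Theorems/ChiralWindowDefsBoxAt.lean`).  Targets, tolerances and the accuracy budget:
`Cruxes/CwKLChiralWindow/CertTarget-c5.md` (every inequality in decimal, §2); strips: `StripBounds-c5.md`; acceptance test `contain.py` (Tools-c5.md).

* `stub_klCertL_box0` — the POINT box `μ = μ_b = -11053/10000`: this is the certified SIGN CLAIM proper (the `E` bottom below `B1g` and `B2g` at `μ_b`,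
  clause (ii) of the crux) and needs no transport in `μ`.  Do this first; it also kills the disprover's only remaining attack (exact tie).
* `stub_klCertL_box3` — the POINT box `μ = μ_a = -441/400`: `B1g` leads (clause (i)); no transport.
* `stub_klCertL_box1`, `stub_klCertL_box2` — the interior boxes `[μ_b, -11039/10000]`, `[-11039/10000, μ_a]` (width 1.4e-3): two-channel isolation and
  node covering uniformly in `μ` (hull bounds; first-order Taylor models in `μ` fit, CertTarget-c5 §4).
Composition: `KLCert.boxEnclosures_of_forall` (p142172) assembles `klCertL.BoxEnclosures` from the four boxes (`klCertL.boxes.length = 4`), and the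
landed endpoint `cwKLChiralWindow_of_klCertL_boxes : klCertL.BoxEnclosures → CwKLChiralWindow` (p141554: E0 by `stub_klFillingLower/Upper` +
`monotone_filling`, `E_x`-form checker soundness and `cwKLChiralWindow_of_klCertX`, witness channel `χs = E`) concludes.
History: v8 (c4) `∃ c, c.checkR ∧ c.EnclosuresRS`; v9b (c5) E0 split off and proved; v10 (c5) one stub `klCertL.BoxEnclosures`; v11 (c5) per box.
-/

noncomputable section

set_option linter.dupNamespace false

namespace Summit.HubbardSuperconductivity.HubbardSuperconductivity.Theorems

open MeasureTheory Literature.MathematicalPhysics.QuantumLattice CwKLChiralWindow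
open Summit.HubbardSuperconductivity.HubbardSuperconductivity.Theses.ChiralWindow

/-! ### Stubs (certified computations, one per box of `klCertL`) -/

/-- **Box 0 of `klCertL` (the point `μ_b = -11053/10000`): certified enclosures E1–E4, E5S, E6** — the sign claim proper.
[cite: RaghuKivelsonScalapino2010, §III Fig. 2; SimkovicEtAl2016, §3.1] -/
theorem stub_klCertL_box0 : klCertL.BoxEnclosureAt 0 := by
  sorry

/-- **Box 1 of `klCertL` (`[-11053/10000, -11039/10000]`): certified enclosures, uniformly in `μ`.** [cite: RaghuKivelsonScalapino2010, §III Fig. 2] -/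
theorem stub_klCertL_box1 : klCertL.BoxEnclosureAt 1 := by
  sorry

/-- **Box 2 of `klCertL` (`[-11039/10000, -441/400]`): certified enclosures, uniformly in `μ`.** [cite: RaghuKivelsonScalapino2010, §III Fig. 2] -/
theorem stub_klCertL_box2 : klCertL.BoxEnclosureAt 2 := by
  sorry

/-- **Box 3 of `klCertL` (the point `μ_a = -441/400`): certified enclosures E1–E4, E5S, E6.** [cite: RaghuKivelsonScalapino2010, §III Fig. 2] -/
theorem stub_klCertL_box3 : klCertL.BoxEnclosureAt 3 := by
  sorry

/-! ### Composition -/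

/-- The record `klCertL` has exactly four boxes. [folklore] -/
theorem klc11_boxes_length : klCertL.boxes.length = 4 := by
  rfl

/-- The box part of the numerical hypothesis for `klCertL` from its four boxes. [folklore] -/
theorem klc11_boxEnclosures : klCertL.BoxEnclosures := by
  refine KLCert.boxEnclosures_of_forall klCertL ?_
  intro i hi
  rw [klc11_boxes_length] at hi
  interval_cases i
  · exact stub_klCertL_box0
  · exact stub_klCertL_box1
  · exact stub_klCertL_box2
  · exact stub_klCertL_box3

/-- **The crux from the four per-box stubs.** [folklore] -/
theorem CwKLChiralWindow_of : CwKLChiralWindow :=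
  cwKLChiralWindow_of_klCertL_boxes klc11_boxEnclosures

end Summit.HubbardSuperconductivity.HubbardSuperconductivity.Theorems

end
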